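import Literature.NumberTheory.DiophantineGeometry.GenEllDeCoverFarFromCuspsFamilyD3
import Literature.NumberTheory.DiophantineGeometry.GenEllDeCoverFarFromCuspsD3
import Literature.NumberTheory.DiophantineGeometry.GenEllDeFibresPolynomial
import Literature.NumberTheory.DiophantineGeometry.GenEllDePoint

/-!
# [GenEll] Thm 2.1 for `ℙ¹` (route piece W7, family `t_c`): `hZfar ∧ hZmem` in the currency of the
# persistent spine — bad set = the roots of ONE `g ∈ ℚ[X]` (e.g. the resultant), cover point = `dePoint`

Support file for `GenEllTwo` (stmt-ABC-19679; S. Mochizuki, *Arithmetic elliptic curves in general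
position*, Math. J. Okayama Univ. **52** (2010), Thm. 2.1 (ii) ⇒ (i), proof p. 12
[cite: MochizukiGenEll2010, Thm 2.1 proof p.12]; abc-iut cell, package map `GENELLTWO-P1ROUTE.md`
of seat abc-iut-S6, W7 «properness»; S6 ASSIGNMENT 2026-08-26T02:02:38Z «GenEllMechanismAssembly»
(w5-d075): the mechanism set of `GenEllConjugateAvoidancePlaces.vojtaIneq_univ_of_persistent_places`
is `T = {P | (∀ σ : P.F →+* ℂ, ∀ a ∈ g.aroots ℂ, r < ‖σ P.x − a‖) ∧ (∀ l, ∀ σ : P.F →+* ℚ̄_{pr l},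
∀ a ∈ g.aroots ℚ̄_{pr l}, r < ‖σ P.x − a‖)}` for ONE `g ∈ ℚ[X]`, and `hZfar`/`hZmem` of
`GenEllPhiMechanismPlaces.vojtaIneq_of_belyi_mechanism_of_subset` (taken with `S = S₀ = {2}`,
w5-d075 WIRING NOTE 02:00:04Z (1)) are to be read off `T`-membership with
`Z P := (P.dePoint e).imageAt (β(t_c))` (w5-d015's `GenEllDePoint`)).

This file closes the gap between `GenEllDeCoverFarFromCuspsFamilyD3.exists_farFromCusps_phi_c_of_base`
(avoidance hypothesis through finite sets `Xℂ`, `X₂` CONTAINING the `x`-coordinates of the fibre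
`E_φ`) and that currency:
* `exists_farFromCusps_imageAt_of_far_aroots` — `hZfar ∧ hZmem` for EVERY presentation `Q` of the
  cover point (`ι : P.F →+* Q.F`, `r ∈ Q.F`, `r^{2k+1} = ιx(1 − ιx)`), from the two `T`-membership
  binders at `∞` and at the place `2` VERBATIM (`ρ < ‖σ P.x − a‖`, `a ∈ g.aroots _`), for ANY
  `g ∈ ℚ[X]` whose roots in `ℂ` and in `ℚ̄₂` contain the `x`-coordinates of the non-pole fibre points
  (so any MULTIPLE of the resultant below also qualifies);
* `De.fst_mem_aroots_resultant_of_fibre` — the junction: over ANY algebraically closed `Ω ⊇ ℚ`, the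
  `x`-coordinate of a non-pole point `P' ∈ D_e(Ω)` with `p(t_c P') = 0 ∨ q(t_c P') = 0 ∨
  (p − q)(t_c P') = 0` is a root of `g := Res_r(curvePoly, G_{p·q·(p−q)})`
  (w5-d015's `De.rootSet_resultant_homFibrePolyC`, p416107), and `…_of_dvd` for its multiples —
  so the containment hypotheses are discharged once and for all for that `g`
  (`exists_farFromCusps_imageAt_of_far_aroots_resultant`);
* `exists_farFromCusps_dePoint_imageAt` (+ `_resultant`) — the same with `Q := P.dePoint (2k+1)`,
  `ι := algebraMap`, `r := P.deRoot (2k+1)`; side conditions reduced to `P ∈ UPle d` and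
  `1 − 2·P.x ≠ 0`; `Z P ∈ UPle ((2k+1)·d)`;
* `forall_padicAlgCl_aroots_of_eq` — transport of the place-`l` binder along `pr l = 2`
  (for `Λ`-indexed place families).

Theorems only (no definitions, no named facts); classical; nothing here bears on [IUTchIII] Cor. 3.12.
-/

namespace Literature.NumberTheory.DiophantineGeometry.GenEll

open Polynomial NumberField

/-! ### The junction: fibre `x`-coordinates are roots of the resultant (or of any multiple) -/

section Junction

variable {Ω : Type*} [Field Ω] [CharZero Ω] [IsAlgClosed Ω]

/-- **Junction W7 ↔ spine.** For `c ≠ 0`, `p, q ≠ 0`, `p ≠ q` and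
`g := Res_r(curvePoly k, G_{p·q·(p−q)}) ∈ ℚ[X]` (`De.homFibrePolyC`), every non-pole point
`P' = (x, r)` of `D_e(Ω)` (`r^{2k+1} = x(1−x)`, `r ≠ 0`, `1 − 2x ≠ 0`), `Ω` algebraically closed of
characteristic `0`, with `p(t_c P') = 0 ∨ q(t_c P') = 0 ∨ (p − q)(t_c P') = 0`,
`t_c = ((1−2x) + c·r^{k+2})/(r(1−2x))`, has `x ∈ g.aroots Ω`: the bad set `x(φ_c⁻¹{0, ∞, 1})` is
contained in the root set of ONE rational polynomial, at every place.
[cite: MochizukiGenEll2010, Thm 2.1 proof p.12] -/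
theorem De.fst_mem_aroots_resultant_of_fibre (k : ℕ) {c : ℚ} (hc : c ≠ 0) {p q : ℚ[X]}
    (hp0 : p ≠ 0) (hq0 : q ≠ 0) (hne : p ≠ q) (P' : Ω × Ω)
    (hcurve : P'.2 ^ (2 * k + 1) = P'.1 * (1 - P'.1)) (hr : P'.2 ≠ 0) (hs : 1 - 2 * P'.1 ≠ 0)
    (hfib : aeval (((1 - 2 * P'.1) + algebraMap ℚ Ω c * P'.2 ^ (k + 2)) / (P'.2 * (1 - 2 * P'.1))) p
          = 0 ∨
        aeval (((1 - 2 * P'.1) + algebraMap ℚ Ω c * P'.2 ^ (k + 2)) / (P'.2 * (1 - 2 * P'.1))) q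
          = 0 ∨
        aeval (((1 - 2 * P'.1) + algebraMap ℚ Ω c * P'.2 ^ (k + 2)) / (P'.2 * (1 - 2 * P'.1)))
          (p - q) = 0) :
    P'.1 ∈ (resultant (De.curvePoly k) (De.homFibrePolyC k c (p * q * (p - q)))).aroots Ω := by
  classical
  have hm : p * q * (p - q) ≠ 0 := mul_ne_zero (mul_ne_zero hp0 hq0) (sub_ne_zero.mpr hne)
  have hmem : P'.1 ∈
      (resultant (De.curvePoly k) (De.homFibrePolyC k c (p * q * (p - q)))).rootSet Ω := by
    rw [De.rootSet_resultant_homFibrePolyC k hc hm]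
    refine ⟨P'.2, hcurve, hr, hs, ?_⟩
    rw [map_mul, map_mul]
    rcases hfib with h | h | h
    · rw [h, zero_mul, zero_mul]
    · rw [h, mul_zero, zero_mul]
    · rw [h, mul_zero]
  rw [Polynomial.mem_rootSet] at hmem
  exact Polynomial.mem_aroots.mpr hmem

/-- The same for any nonzero MULTIPLE `g'` of the resultant (e.g. the resultant times the
configuration-independent factors an assembly may wish to keep away from): roots only grow.
[cite: MochizukiGenEll2010, Thm 2.1 proof p.12] -/
theorem De.fst_mem_aroots_of_resultant_dvd (k : ℕ) {c : ℚ} (hc : c ≠ 0) {p q : ℚ[X]}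
    (hp0 : p ≠ 0) (hq0 : q ≠ 0) (hne : p ≠ q) {g' : ℚ[X]} (hg' : g' ≠ 0)
    (hdvd : resultant (De.curvePoly k) (De.homFibrePolyC k c (p * q * (p - q))) ∣ g') (P' : Ω × Ω)
    (hcurve : P'.2 ^ (2 * k + 1) = P'.1 * (1 - P'.1)) (hr : P'.2 ≠ 0) (hs : 1 - 2 * P'.1 ≠ 0)
    (hfib : aeval (((1 - 2 * P'.1) + algebraMap ℚ Ω c * P'.2 ^ (k + 2)) / (P'.2 * (1 - 2 * P'.1))) p
          = 0 ∨
        aeval (((1 - 2 * P'.1) + algebraMap ℚ Ω c * P'.2 ^ (k + 2)) / (P'.2 * (1 - 2 * P'.1))) q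
          = 0 ∨
        aeval (((1 - 2 * P'.1) + algebraMap ℚ Ω c * P'.2 ^ (k + 2)) / (P'.2 * (1 - 2 * P'.1)))
          (p - q) = 0) :
    P'.1 ∈ g'.aroots Ω := by
  have h := De.fst_mem_aroots_resultant_of_fibre k hc hp0 hq0 hne P' hcurve hr hs hfib
  rw [Polynomial.mem_aroots] at h ⊢
  obtain ⟨u, hu⟩ := hdvd
  refine ⟨hg', ?_⟩
  rw [hu, map_mul, h.2, zero_mul]

end Junction

/-! ### `hZfar ∧ hZmem` from `T`-membership, any presentation of the cover point, any `g` -/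

section Presentation

/-- **W7 in the spine's currency, any presentation, any bad polynomial `g`.**  Fix `k` (`e = 2k+1`),
`c ∈ ℚ^×`, `β = p/q` (`p, q ∈ ℚ[X]` of the same degree `n` as `p − q`, `p, q ≠ 0`, `p ≠ q`), a
margin `ρ > 0`, a degree bound `N`, and `g ∈ ℚ[X]` whose roots in `ℂ` and in `ℚ̄₂` contain the
`x`-coordinates of the non-pole points `P' ∈ D_e` with `β(t_c P') ∈ {0, ∞, 1}`.  There is
`ρ' ∈ (0, 1/2]` such that for every `P : NFPoint` in the mechanism set — `ρ < ‖σ P.x − a‖` for every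
`σ : P.F →+* ℂ`, `a ∈ g.aroots ℂ`, and every `σ : P.F →+* ℚ̄₂`, `a ∈ g.aroots ℚ̄₂` — and every
presentation `Q` of a `D_e`-point over `P` (`ι : P.F →+* Q.F`, `r ∈ Q.F`, `r^{2k+1} = ιx(1 − ιx)`,
`r ≠ 0`, `1 − 2ιx ≠ 0`, `[Q.F:ℚ] ≤ N`), the re-presented image `Z := Q.imageAt (β(t_c(ιx, r)))` is
`NFPoint.FarFromCusps {2} ρ'` and lies in `UPle N` (`hZfar`, `hZmem`).
[cite: MochizukiGenEll2010, Thm 2.1 proof p.12] -/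
theorem exists_farFromCusps_imageAt_of_far_aroots (k : ℕ) {c : ℚ} (hc : c ≠ 0) {p q : ℚ[X]}
    {n : ℕ} (hpn : p.natDegree = n) (hqn : q.natDegree = n) (hpqn : (p - q).natDegree = n)
    (hp0 : p ≠ 0) (hq0 : q ≠ 0) (hne : p ≠ q) {ρ : ℝ} (hρ : 0 < ρ) (N : ℕ) (g : ℚ[X])
    (hgℂ : ∀ P' : ℂ × ℂ, P'.2 ^ (2 * k + 1) = P'.1 * (1 - P'.1) → P'.2 ≠ 0 → 1 - 2 * P'.1 ≠ 0 →
      (aeval (((1 - 2 * P'.1) + algebraMap ℚ ℂ c * P'.2 ^ (k + 2)) / (P'.2 * (1 - 2 * P'.1))) p = 0 ∨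
        aeval (((1 - 2 * P'.1) + algebraMap ℚ ℂ c * P'.2 ^ (k + 2)) / (P'.2 * (1 - 2 * P'.1))) q = 0 ∨
        aeval (((1 - 2 * P'.1) + algebraMap ℚ ℂ c * P'.2 ^ (k + 2)) / (P'.2 * (1 - 2 * P'.1))) (p - q)
          = 0) →
      P'.1 ∈ g.aroots ℂ)
    (hg₂ : ∀ P' : PadicAlgCl 2 × PadicAlgCl 2, P'.2 ^ (2 * k + 1) = P'.1 * (1 - P'.1) → P'.2 ≠ 0 →
      1 - 2 * P'.1 ≠ 0 →
      (aeval (((1 - 2 * P'.1) + algebraMap ℚ (PadicAlgCl 2) c * P'.2 ^ (k + 2)) /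
            (P'.2 * (1 - 2 * P'.1))) p = 0 ∨
        aeval (((1 - 2 * P'.1) + algebraMap ℚ (PadicAlgCl 2) c * P'.2 ^ (k + 2)) /
            (P'.2 * (1 - 2 * P'.1))) q = 0 ∨
        aeval (((1 - 2 * P'.1) + algebraMap ℚ (PadicAlgCl 2) c * P'.2 ^ (k + 2)) /
            (P'.2 * (1 - 2 * P'.1))) (p - q) = 0) →
      P'.1 ∈ g.aroots (PadicAlgCl 2)) :
    ∃ ρ' : ℝ, 0 < ρ' ∧ ρ' ≤ 1 / 2 ∧
      ∀ P : NFPoint,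
        (∀ σ : P.F →+* ℂ, ∀ a ∈ g.aroots ℂ, ρ < ‖σ P.x - a‖) →
        (∀ σ : P.F →+* PadicAlgCl 2, ∀ a ∈ g.aroots (PadicAlgCl 2), ρ < ‖σ P.x - a‖) →
      ∀ (Q : NFPoint) (ι : P.F →+* Q.F) (r : Q.F), Q.degree ≤ N →
        r ^ (2 * k + 1) = ι P.x * (1 - ι P.x) → r ≠ 0 → 1 - 2 * ι P.x ≠ 0 →
      NFPoint.FarFromCusps ({2} : Finset ℕ) ρ'
          (Q.imageAt
            (aeval (((1 - 2 * ι P.x) + algebraMap ℚ Q.F c * r ^ (k + 2)) / (r * (1 - 2 * ι P.x))) p /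
              aeval (((1 - 2 * ι P.x) + algebraMap ℚ Q.F c * r ^ (k + 2)) / (r * (1 - 2 * ι P.x)))
                q)) ∧
        Q.imageAt
            (aeval (((1 - 2 * ι P.x) + algebraMap ℚ Q.F c * r ^ (k + 2)) / (r * (1 - 2 * ι P.x))) p /
              aeval (((1 - 2 * ι P.x) + algebraMap ℚ Q.F c * r ^ (k + 2)) / (r * (1 - 2 * ι P.x)))
                q) ∈ UPle N := by
  classical
  obtain ⟨ρ', h0, h1, h⟩ := exists_farFromCusps_phi_c_of_base k hc hpn hqn hpqn hp0 hq0 hne hρ N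
    (Xℂ := (g.aroots ℂ).toFinset)
    (fun P' hc' hr' hs' hfib => Multiset.mem_toFinset.mpr (hgℂ P' hc' hr' hs' hfib))
    (X₂ := (g.aroots (PadicAlgCl 2)).toFinset)
    (fun P' hc' hr' hs' hfib => Multiset.mem_toFinset.mpr (hg₂ P' hc' hr' hs' hfib))
  refine ⟨ρ', h0, h1, fun P hPℂ hP₂ Q ι r hQ hcurve hr hs => ?_⟩
  have key := h P
    (fun σ ξ hξ => by rw [dist_eq_norm]; exact (hPℂ σ ξ (Multiset.mem_toFinset.mp hξ)).le)
    (fun σ ξ hξ => by rw [dist_eq_norm]; exact (hP₂ σ ξ (Multiset.mem_toFinset.mp hξ)).le)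
    Q.F hQ ι r hcurve hr hs
  have hU := NFPoint.FarFromCusps.inU key h0.le
  exact ⟨NFPoint.farFromCusps_imageAt Q _ key, NFPoint.imageAt_mem_UPle Q hU.1 hU.2 (d := N) hQ⟩

/-- **W7 in the spine's currency, any presentation, `g :=` the resultant** (no containment
hypothesis: `De.fst_mem_aroots_resultant_of_fibre` at `ℂ` and at `ℚ̄₂`).
[cite: MochizukiGenEll2010, Thm 2.1 proof p.12] -/
theorem exists_farFromCusps_imageAt_of_far_aroots_resultant (k : ℕ) {c : ℚ} (hc : c ≠ 0)
    {p q : ℚ[X]} {n : ℕ} (hpn : p.natDegree = n) (hqn : q.natDegree = n)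
    (hpqn : (p - q).natDegree = n) (hp0 : p ≠ 0) (hq0 : q ≠ 0) (hne : p ≠ q) {ρ : ℝ} (hρ : 0 < ρ)
    (N : ℕ) :
    ∃ ρ' : ℝ, 0 < ρ' ∧ ρ' ≤ 1 / 2 ∧
      ∀ P : NFPoint,
        (∀ σ : P.F →+* ℂ,
          ∀ a ∈ (resultant (De.curvePoly k) (De.homFibrePolyC k c (p * q * (p - q)))).aroots ℂ,
            ρ < ‖σ P.x - a‖) →
        (∀ σ : P.F →+* PadicAlgCl 2,
          ∀ a ∈ (resultant (De.curvePoly k) (De.homFibrePolyC k c (p * q * (p - q)))).aroots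
            (PadicAlgCl 2), ρ < ‖σ P.x - a‖) →
      ∀ (Q : NFPoint) (ι : P.F →+* Q.F) (r : Q.F), Q.degree ≤ N →
        r ^ (2 * k + 1) = ι P.x * (1 - ι P.x) → r ≠ 0 → 1 - 2 * ι P.x ≠ 0 →
      NFPoint.FarFromCusps ({2} : Finset ℕ) ρ'
          (Q.imageAt
            (aeval (((1 - 2 * ι P.x) + algebraMap ℚ Q.F c * r ^ (k + 2)) / (r * (1 - 2 * ι P.x))) p /
              aeval (((1 - 2 * ι P.x) + algebraMap ℚ Q.F c * r ^ (k + 2)) / (r * (1 - 2 * ι P.x)))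
                q)) ∧
        Q.imageAt
            (aeval (((1 - 2 * ι P.x) + algebraMap ℚ Q.F c * r ^ (k + 2)) / (r * (1 - 2 * ι P.x))) p /
              aeval (((1 - 2 * ι P.x) + algebraMap ℚ Q.F c * r ^ (k + 2)) / (r * (1 - 2 * ι P.x)))
                q) ∈ UPle N :=
  exists_farFromCusps_imageAt_of_far_aroots k hc hpn hqn hpqn hp0 hq0 hne hρ N _
    (fun P' hc' hr' hs' hfib => De.fst_mem_aroots_resultant_of_fibre k hc hp0 hq0 hne P' hc' hr' hs'
      hfib)
    (fun P' hc' hr' hs' hfib => De.fst_mem_aroots_resultant_of_fibre k hc hp0 hq0 hne P' hc' hr' hs'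
      hfib)

/-- **Transport of the place binder along an equality of primes** (bookkeeping for `Λ`-indexed
place families `pr : Λ → ℕ` with `pr l₂ = 2`, the convention of
`GenEllConjugateAvoidancePlaces`: the `T`-membership clause at `l₂` IS the clause at the place `2`
— "`V ⊆ V(ℚ)` a finite subset that contains `V(ℚ)^arc` and `Σ`", here `2 ∈ Σ`).
[cite: MochizukiGenEll2010, Thm 2.1 proof p.12] -/
theorem forall_padicAlgCl_aroots_of_eq {P : NFPoint} (g : ℚ[X]) (ρ : ℝ) {ℓ ℓ' : ℕ}
    [Fact ℓ.Prime] [Fact ℓ'.Prime] (hℓ : ℓ = ℓ')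
    (H : ∀ σ : P.F →+* PadicAlgCl ℓ, ∀ a ∈ g.aroots (PadicAlgCl ℓ), ρ < ‖σ P.x - a‖) :
    ∀ σ : P.F →+* PadicAlgCl ℓ', ∀ a ∈ g.aroots (PadicAlgCl ℓ'), ρ < ‖σ P.x - a‖ := by
  subst hℓ
  exact H

end Presentation

/-! ### `hZfar ∧ hZmem` with the cover point `P.dePoint e` -/

section DePoint

/-- **W7 in the spine's currency, cover point `dePoint`, any bad polynomial `g`.**  With the data of
`exists_farFromCusps_imageAt_of_far_aroots` and a degree `d`: there is `ρ' ∈ (0, 1/2]` such that for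
every `P ∈ U_P(ℚ̄)^{≤d}` in the mechanism set (binders at `∞` and at `2` as there) with `1 − 2·x ≠ 0`,
the point `Z P := (P.dePoint (2k+1)).imageAt (β(t_c(x, r)))`, `r := P.deRoot (2k+1)`
(`r^{2k+1} = x(1−x)` in `F(r)`), is `NFPoint.FarFromCusps {2} ρ'` and lies in `UPle ((2k+1)·d)` —
`hZfar` and `hZmem` of `vojtaIneq_of_belyi_mechanism_of_subset` with `Q P := P.dePoint (2k+1)`,
`d' := (2k+1)·d`. [cite: MochizukiGenEll2010, Thm 2.1 proof p.12] -/
theorem exists_farFromCusps_dePoint_imageAt (k : ℕ) {c : ℚ} (hc : c ≠ 0) {p q : ℚ[X]}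
    {n : ℕ} (hpn : p.natDegree = n) (hqn : q.natDegree = n) (hpqn : (p - q).natDegree = n)
    (hp0 : p ≠ 0) (hq0 : q ≠ 0) (hne : p ≠ q) {ρ : ℝ} (hρ : 0 < ρ) (d : ℕ) (g : ℚ[X])
    (hgℂ : ∀ P' : ℂ × ℂ, P'.2 ^ (2 * k + 1) = P'.1 * (1 - P'.1) → P'.2 ≠ 0 → 1 - 2 * P'.1 ≠ 0 →
      (aeval (((1 - 2 * P'.1) + algebraMap ℚ ℂ c * P'.2 ^ (k + 2)) / (P'.2 * (1 - 2 * P'.1))) p = 0 ∨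
        aeval (((1 - 2 * P'.1) + algebraMap ℚ ℂ c * P'.2 ^ (k + 2)) / (P'.2 * (1 - 2 * P'.1))) q = 0 ∨
        aeval (((1 - 2 * P'.1) + algebraMap ℚ ℂ c * P'.2 ^ (k + 2)) / (P'.2 * (1 - 2 * P'.1))) (p - q)
          = 0) →
      P'.1 ∈ g.aroots ℂ)
    (hg₂ : ∀ P' : PadicAlgCl 2 × PadicAlgCl 2, P'.2 ^ (2 * k + 1) = P'.1 * (1 - P'.1) → P'.2 ≠ 0 →
      1 - 2 * P'.1 ≠ 0 →
      (aeval (((1 - 2 * P'.1) + algebraMap ℚ (PadicAlgCl 2) c * P'.2 ^ (k + 2)) /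
            (P'.2 * (1 - 2 * P'.1))) p = 0 ∨
        aeval (((1 - 2 * P'.1) + algebraMap ℚ (PadicAlgCl 2) c * P'.2 ^ (k + 2)) /
            (P'.2 * (1 - 2 * P'.1))) q = 0 ∨
        aeval (((1 - 2 * P'.1) + algebraMap ℚ (PadicAlgCl 2) c * P'.2 ^ (k + 2)) /
            (P'.2 * (1 - 2 * P'.1))) (p - q) = 0) →
      P'.1 ∈ g.aroots (PadicAlgCl 2)) :
    ∃ ρ' : ℝ, 0 < ρ' ∧ ρ' ≤ 1 / 2 ∧
      ∀ P : NFPoint,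
        (∀ σ : P.F →+* ℂ, ∀ a ∈ g.aroots ℂ, ρ < ‖σ P.x - a‖) →
        (∀ σ : P.F →+* PadicAlgCl 2, ∀ a ∈ g.aroots (PadicAlgCl 2), ρ < ‖σ P.x - a‖) →
        P ∈ UPle d → 1 - 2 * P.x ≠ 0 →
      NFPoint.FarFromCusps ({2} : Finset ℕ) ρ'
          ((P.dePoint (2 * k + 1)).imageAt
            (aeval (((1 - 2 * (P.dePoint (2 * k + 1)).x) +
                  algebraMap ℚ (P.deField (2 * k + 1)) c * P.deRoot (2 * k + 1) ^ (k + 2)) /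
                (P.deRoot (2 * k + 1) * (1 - 2 * (P.dePoint (2 * k + 1)).x))) p /
              aeval (((1 - 2 * (P.dePoint (2 * k + 1)).x) +
                  algebraMap ℚ (P.deField (2 * k + 1)) c * P.deRoot (2 * k + 1) ^ (k + 2)) /
                (P.deRoot (2 * k + 1) * (1 - 2 * (P.dePoint (2 * k + 1)).x))) q)) ∧
        (P.dePoint (2 * k + 1)).imageAt
            (aeval (((1 - 2 * (P.dePoint (2 * k + 1)).x) +
                  algebraMap ℚ (P.deField (2 * k + 1)) c * P.deRoot (2 * k + 1) ^ (k + 2)) /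
                (P.deRoot (2 * k + 1) * (1 - 2 * (P.dePoint (2 * k + 1)).x))) p /
              aeval (((1 - 2 * (P.dePoint (2 * k + 1)).x) +
                  algebraMap ℚ (P.deField (2 * k + 1)) c * P.deRoot (2 * k + 1) ^ (k + 2)) /
                (P.deRoot (2 * k + 1) * (1 - 2 * (P.dePoint (2 * k + 1)).x))) q) ∈
          UPle ((2 * k + 1) * d) := by
  obtain ⟨ρ', h0, h1, h⟩ :=
    exists_farFromCusps_imageAt_of_far_aroots k hc hpn hqn hpqn hp0 hq0 hne hρ ((2 * k + 1) * d) g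
      hgℂ hg₂
  refine ⟨ρ', h0, h1, fun P hPℂ hP₂ hP hs => ?_⟩
  have he : 0 < 2 * k + 1 := by omega
  have hinj := (algebraMap P.F (P.deField (2 * k + 1))).injective
  -- the curve equation, the non-vanishing of `r` and of `1 − 2x` in `F(r)`
  have hcurve : P.deRoot (2 * k + 1) ^ (2 * k + 1) =
      algebraMap P.F (P.deField (2 * k + 1)) P.x *
        (1 - algebraMap P.F (P.deField (2 * k + 1)) P.x) := by
    rw [P.deRoot_pow (2 * k + 1) he, map_mul, map_sub, map_one]
  have hr : P.deRoot (2 * k + 1) ≠ 0 := by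
    intro h0'
    have hx : P.x * (1 - P.x) = 0 := by
      apply hinj
      rw [map_zero, ← P.deRoot_pow (2 * k + 1) he, h0', zero_pow (by omega)]
    rcases mul_eq_zero.mp hx with hx | hx
    · exact hP.1.1.1 hx
    · exact hP.1.1.2 (by rwa [sub_eq_zero, eq_comm] at hx)
  have hs' : 1 - 2 * algebraMap P.F (P.deField (2 * k + 1)) P.x ≠ 0 := by
    have : algebraMap P.F (P.deField (2 * k + 1)) (1 - 2 * P.x) ≠ 0 :=
      (map_ne_zero_iff _ hinj).mpr hs
    simpa [map_sub, map_mul, map_one, map_ofNat] using this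
  exact h P hPℂ hP₂ (P.dePoint (2 * k + 1)) (algebraMap P.F (P.deField (2 * k + 1)))
    (P.deRoot (2 * k + 1)) (P.degree_dePoint_le_of_le _ he hP.2 le_rfl) hcurve hr hs'

/-- **W7 in the spine's currency, cover point `dePoint`, `g :=` the resultant** (no containment
hypothesis). [cite: MochizukiGenEll2010, Thm 2.1 proof p.12] -/
theorem exists_farFromCusps_dePoint_imageAt_resultant (k : ℕ) {c : ℚ} (hc : c ≠ 0) {p q : ℚ[X]}
    {n : ℕ} (hpn : p.natDegree = n) (hqn : q.natDegree = n) (hpqn : (p - q).natDegree = n)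
    (hp0 : p ≠ 0) (hq0 : q ≠ 0) (hne : p ≠ q) {ρ : ℝ} (hρ : 0 < ρ) (d : ℕ) :
    ∃ ρ' : ℝ, 0 < ρ' ∧ ρ' ≤ 1 / 2 ∧
      ∀ P : NFPoint,
        (∀ σ : P.F →+* ℂ,
          ∀ a ∈ (resultant (De.curvePoly k) (De.homFibrePolyC k c (p * q * (p - q)))).aroots ℂ,
            ρ < ‖σ P.x - a‖) →
        (∀ σ : P.F →+* PadicAlgCl 2,
          ∀ a ∈ (resultant (De.curvePoly k) (De.homFibrePolyC k c (p * q * (p - q)))).aroots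
            (PadicAlgCl 2), ρ < ‖σ P.x - a‖) →
        P ∈ UPle d → 1 - 2 * P.x ≠ 0 →
      NFPoint.FarFromCusps ({2} : Finset ℕ) ρ'
          ((P.dePoint (2 * k + 1)).imageAt
            (aeval (((1 - 2 * (P.dePoint (2 * k + 1)).x) +
                  algebraMap ℚ (P.deField (2 * k + 1)) c * P.deRoot (2 * k + 1) ^ (k + 2)) /
                (P.deRoot (2 * k + 1) * (1 - 2 * (P.dePoint (2 * k + 1)).x))) p /
              aeval (((1 - 2 * (P.dePoint (2 * k + 1)).x) +
                  algebraMap ℚ (P.deField (2 * k + 1)) c * P.deRoot (2 * k + 1) ^ (k + 2)) /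
                (P.deRoot (2 * k + 1) * (1 - 2 * (P.dePoint (2 * k + 1)).x))) q)) ∧
        (P.dePoint (2 * k + 1)).imageAt
            (aeval (((1 - 2 * (P.dePoint (2 * k + 1)).x) +
                  algebraMap ℚ (P.deField (2 * k + 1)) c * P.deRoot (2 * k + 1) ^ (k + 2)) /
                (P.deRoot (2 * k + 1) * (1 - 2 * (P.dePoint (2 * k + 1)).x))) p /
              aeval (((1 - 2 * (P.dePoint (2 * k + 1)).x) +
                  algebraMap ℚ (P.deField (2 * k + 1)) c * P.deRoot (2 * k + 1) ^ (k + 2)) /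
                (P.deRoot (2 * k + 1) * (1 - 2 * (P.dePoint (2 * k + 1)).x))) q) ∈
          UPle ((2 * k + 1) * d) :=
  exists_farFromCusps_dePoint_imageAt k hc hpn hqn hpqn hp0 hq0 hne hρ d _
    (fun P' hc' hr' hs' hfib => De.fst_mem_aroots_resultant_of_fibre k hc hp0 hq0 hne P' hc' hr' hs'
      hfib)
    (fun P' hc' hr' hs' hfib => De.fst_mem_aroots_resultant_of_fibre k hc hp0 hq0 hne P' hc' hr' hs'
      hfib)

end DePoint

end Literature.NumberTheory.DiophantineGeometry.GenEll
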